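import Mathlib
import Literature.MathematicalPhysics.QuantumLattice.WilsonDiracAP
import Summits.QuantumFields.QCD.Theorems.QuarksAsStableActionDefs
import HarnessLib

/-!
# Time-translation covariance of the bond-diluted signed partition function
(stub `stub_shiftZb` of crux stmt-QuantumFields-9735, line Sketch)

`Zb(slabBonds (a + 1) ℓ) = Zb(slabBonds a ℓ)` for the signed, bond-diluted, un-normalised
Wilson-quark partition function `Zb(E) = ∫ ∏_f det D_E[U, m_f] e^{-β S_W(U)} ∏ dU` of `SU(3)`
(`bondWilsonDiracAP`, `slabBonds` of `QuarksAsStableActionDefs`).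

Proof: change variables `U ↦ τ_v U` (`v = ê₀`, `torusConfigShift`) in the product Haar integral
(`MeasureTheory.measurePreserving_arrowCongr'`); the Wilson action is translation invariant
(`wilsonAction_torusConfigShift`), and the diluted determinant is covariant:

* `bondWilsonDirac ρ E' (τ_v U) m r` is `bondWilsonDirac ρ E U m r` reindexed by the site shift
  when `E'` is the translate of `E` (`ShiftZb.bondWilsonDirac_torusConfigShift`), and the translate
  of `slabBonds a ℓ` by `ê₀` is `slabBonds (a + 1) ℓ` (`ShiftZb.mem_slabBonds_add_one_iff`);
* the antiperiodic lift of the translated field is the translate of the lift with its seams moved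
  by `-v` (`apTwistAt_torusConfigShift`), and moving a seam is a `ℤ₂ ⊂ U(N)` gauge transformation
  (`apTwistAt_update_succ`) under which the diluted operator is covariant bond by bond
  (`ShiftZb.bondWilsonDirac_gaugeTransform`, the diluted form of the tree's
  `wilsonDirac_gaugeTransform`), so the diluted determinant does not depend on the seams
  (`ShiftZb.det_bondWilsonDirac_apTwistAt`).

References: I. Montvay, G. Münster, *Quantum Fields on a Lattice* (1994) §4.2.4 (4.112)–(4.114),
§5.1.1 (5.3)–(5.5). All statements here are proved.
-/

noncomputable section

open MeasureTheory Matrix Complex Finset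
open Literature.MathematicalPhysics.QuantumFieldTheory Literature.MathematicalPhysics.QuantumLattice
open Literature.Probability.LatticeModels
open Summit.QuantumFields.QCD.Theorems.QuarksAsStableAction
open scoped ComplexConjugate BigOperators ComplexOrder

namespace Summit.QuantumFields.QCD.Theorems.UnquenchedChessboardBoundLine

namespace ShiftZb

section General

variable {L N : ℕ} {G : Type*} [Group G] (ρ : G →* Matrix (Fin N) (Fin N) ℂ)

/-- The diluted operator as mass term minus half the sum of the bond-masked forward and backward
hopping matrices (the diluted form of the tree's `wilsonDirac_eq`). -/
theorem bondWilsonDirac_eq_sub_hops (E : Finset (Edge 4 L)) (U : GaugeConfig 4 L G) (m r : ℝ) :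
    bondWilsonDirac ρ E U m r =
      ((m + 4 * r : ℝ) : ℂ) •
          (1 : Matrix (TorusSite 4 L × Fin N × Fin 4) (TorusSite 4 L × Fin N × Fin 4) ℂ) -
        (1 / 2 : ℂ) • ∑ μ : Fin 4,
          ((Matrix.of fun p q : TorusSite 4 L × Fin N × Fin 4 =>
              if q.1 = Site.shift p.1 μ ∧ (p.1, μ) ∈ E then
                ((r : ℂ) • (1 : Matrix (Fin 4) (Fin 4) ℂ) - euclideanGamma μ) p.2.2 q.2.2 *
                  ρ (U (p.1, μ)) p.2.1 q.2.1
              else 0) +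
            Matrix.of fun p q : TorusSite 4 L × Fin N × Fin 4 =>
              if p.1 = Site.shift q.1 μ ∧ (q.1, μ) ∈ E then
                ((r : ℂ) • (1 : Matrix (Fin 4) (Fin 4) ℂ) + euclideanGamma μ) p.2.2 q.2.2 *
                  ρ (U (q.1, μ))⁻¹ p.2.1 q.2.1
              else 0) := by
  ext p q
  simp only [bondWilsonDirac, Matrix.of_apply, Matrix.sub_apply, Matrix.smul_apply,
    Matrix.one_apply, smul_eq_mul, mul_ite, mul_one, mul_zero, Matrix.sum_apply, Matrix.add_apply]

/-- **Translation covariance of the diluted Wilson–Dirac operator**: if `E'` is the translate by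
`v` of the bond set `E`, then `D_{E'}[τ_v U]` is `D_E[U]` reindexed by `(x, a, α) ↦ (x - v, a, α)`
(the diluted form of the tree's `wilsonDirac_torusConfigShift`). -/
theorem bondWilsonDirac_torusConfigShift [MeasurableSpace G] (v : TorusSite 4 L)
    {E E' : Finset (Edge 4 L)} (hE : ∀ e, e ∈ E' ↔ (e.1 - v, e.2) ∈ E) (U : GaugeConfig 4 L G)
    (m r : ℝ) :
    bondWilsonDirac ρ E' (torusConfigShift v U) m r =
      (bondWilsonDirac ρ E U m r).submatrix (fun p => (p.1 - v, p.2)) (fun p => (p.1 - v, p.2)) := by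
  have hs : ∀ (x : TorusSite 4 L) (μ : Fin 4), Site.shift (x - v) μ = Site.shift x μ - v :=
    fun x μ => by
      simp only [Literature.MathematicalPhysics.QuantumFieldTheory.Site.shift, add_sub_right_comm]
  ext ⟨x, a, α⟩ ⟨y, b, β⟩
  simp only [Matrix.submatrix_apply, bondWilsonDirac, Matrix.of_apply, torusConfigShift_apply,
    Prod.mk.injEq, hs, sub_left_inj, hE]

variable [NeZero L]

/-- **Translation covariance of the diluted determinant**: `det D_{E'}[τ_v U] = det D_E[U]` for
the translate `E'` of `E`. -/
theorem det_bondWilsonDirac_torusConfigShift [MeasurableSpace G] (v : TorusSite 4 L)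
    {E E' : Finset (Edge 4 L)} (hE : ∀ e, e ∈ E' ↔ (e.1 - v, e.2) ∈ E) (U : GaugeConfig 4 L G)
    (m r : ℝ) :
    (bondWilsonDirac ρ E' (torusConfigShift v U) m r).det = (bondWilsonDirac ρ E U m r).det := by
  rw [bondWilsonDirac_torusConfigShift ρ v hE]
  exact Matrix.det_submatrix_equiv_self
    ((Equiv.subRight v).prodCongr (Equiv.refl (Fin N × Fin 4))) _

/-- Gauge covariance of the bond-masked forward hopping matrix:
`H⁺_{E,μ}[U^g] = 𝒢(g) H⁺_{E,μ}[U] 𝒢(g)⁻¹` (as the tree's `wilsonHopFwd_gaugeTransform`). -/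
-- adapted from Literature/MathematicalPhysics/QuantumLattice/WilsonFermionBlockAveraging.lean
theorem hopFwd_gaugeTransform (E : Finset (Edge 4 L)) (g : TorusSite 4 L → G)
    (U : GaugeConfig 4 L G) (r : ℝ) (μ : Fin 4) :
    (Matrix.of fun p q : TorusSite 4 L × Fin N × Fin 4 =>
        if q.1 = Site.shift p.1 μ ∧ (p.1, μ) ∈ E then
          ((r : ℂ) • (1 : Matrix (Fin 4) (Fin 4) ℂ) - euclideanGamma μ) p.2.2 q.2.2 *
            ρ (gaugeTransform g U (p.1, μ)) p.2.1 q.2.1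
        else 0) =
      gaugeRotation ρ (Fin 4) g *
          (Matrix.of fun p q : TorusSite 4 L × Fin N × Fin 4 =>
            if q.1 = Site.shift p.1 μ ∧ (p.1, μ) ∈ E then
              ((r : ℂ) • (1 : Matrix (Fin 4) (Fin 4) ℂ) - euclideanGamma μ) p.2.2 q.2.2 *
                ρ (U (p.1, μ)) p.2.1 q.2.1
            else 0) *
        gaugeRotation ρ (Fin 4) g⁻¹ := by
  ext p q
  rw [mul_gaugeRotation_apply]
  simp_rw [gaugeRotation_mul_apply]
  by_cases h : q.1 = Site.shift p.1 μ ∧ (p.1, μ) ∈ E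
  · obtain ⟨h1, h2⟩ := h
    simp only [Matrix.of_apply, h1, h2, and_self, if_true, gaugeTransform, map_mul, Pi.inv_apply,
      Matrix.mul_apply, Finset.sum_mul, Finset.mul_sum]
    rw [← h1]
    refine Finset.sum_congr rfl fun a _ => Finset.sum_congr rfl fun b _ => ?_
    ring
  · simp [Matrix.of_apply, h]

/-- Gauge covariance of the bond-masked backward hopping matrix:
`H⁻_{E,μ}[U^g] = 𝒢(g) H⁻_{E,μ}[U] 𝒢(g)⁻¹` (as the tree's `wilsonHopBwd_gaugeTransform`). -/
-- adapted from Literature/MathematicalPhysics/QuantumLattice/WilsonFermionBlockAveraging.lean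
theorem hopBwd_gaugeTransform (E : Finset (Edge 4 L)) (g : TorusSite 4 L → G)
    (U : GaugeConfig 4 L G) (r : ℝ) (μ : Fin 4) :
    (Matrix.of fun p q : TorusSite 4 L × Fin N × Fin 4 =>
        if p.1 = Site.shift q.1 μ ∧ (q.1, μ) ∈ E then
          ((r : ℂ) • (1 : Matrix (Fin 4) (Fin 4) ℂ) + euclideanGamma μ) p.2.2 q.2.2 *
            ρ (gaugeTransform g U (q.1, μ))⁻¹ p.2.1 q.2.1
        else 0) =
      gaugeRotation ρ (Fin 4) g *
          (Matrix.of fun p q : TorusSite 4 L × Fin N × Fin 4 =>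
            if p.1 = Site.shift q.1 μ ∧ (q.1, μ) ∈ E then
              ((r : ℂ) • (1 : Matrix (Fin 4) (Fin 4) ℂ) + euclideanGamma μ) p.2.2 q.2.2 *
                ρ (U (q.1, μ))⁻¹ p.2.1 q.2.1
            else 0) *
        gaugeRotation ρ (Fin 4) g⁻¹ := by
  ext p q
  rw [mul_gaugeRotation_apply]
  simp_rw [gaugeRotation_mul_apply]
  by_cases h : p.1 = Site.shift q.1 μ ∧ (q.1, μ) ∈ E
  · obtain ⟨h1, h2⟩ := h
    simp only [Matrix.of_apply, h1, h2, and_self, if_true, gaugeTransform, _root_.mul_inv_rev,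
      inv_inv, map_mul, Pi.inv_apply, Matrix.mul_apply, Finset.sum_mul, Finset.mul_sum]
    rw [← h1]
    refine Finset.sum_comm.trans
      (Finset.sum_congr rfl fun a _ => Finset.sum_congr rfl fun b _ => ?_)
    ring
  · simp [Matrix.of_apply, h]

/-- **Gauge covariance of the diluted Wilson–Dirac operator**: `D_E[U^g] = 𝒢(g) D_E[U] 𝒢(g)⁻¹`
for every bond set `E` and every gauge transformation `g` (bond by bond, as for the tree's
`wilsonDirac_gaugeTransform`; Montvay–Münster §5.1.1 (5.3)–(5.5)). -/
theorem bondWilsonDirac_gaugeTransform (E : Finset (Edge 4 L)) (g : TorusSite 4 L → G)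
    (U : GaugeConfig 4 L G) (m r : ℝ) :
    bondWilsonDirac ρ E (gaugeTransform g U) m r =
      gaugeRotation ρ (Fin 4) g * bondWilsonDirac ρ E U m r * gaugeRotation ρ (Fin 4) g⁻¹ := by
  rw [bondWilsonDirac_eq_sub_hops, bondWilsonDirac_eq_sub_hops]
  simp only [Matrix.mul_sub, Matrix.sub_mul, Matrix.mul_smul, Matrix.smul_mul, Matrix.mul_one,
    gaugeRotation_mul_inv, Matrix.mul_sum, Matrix.sum_mul, Matrix.mul_add, Matrix.add_mul,
    hopFwd_gaugeTransform, hopBwd_gaugeTransform]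

/-- **Gauge invariance of the diluted Wilson fermion determinant**: `det D_E[U^g] = det D_E[U]`. -/
theorem det_bondWilsonDirac_gaugeTransform (E : Finset (Edge 4 L)) (g : TorusSite 4 L → G)
    (U : GaugeConfig 4 L G) (m r : ℝ) :
    (bondWilsonDirac ρ E (gaugeTransform g U) m r).det = (bondWilsonDirac ρ E U m r).det := by
  rw [bondWilsonDirac_gaugeTransform, det_mul, det_mul, mul_right_comm, ← det_mul,
    gaugeRotation_mul_inv, det_one, one_mul]

end General

/-! ## Seam independence and time translation of the diluted antiperiodic determinant -/

section AP

variable {L N : ℕ} [NeZero L]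

/-- Moving the `μ`-seam of the antiperiodic twist anywhere does not change the diluted
determinant (each unit move is the `ℤ₂` gauge transformation `sliceSign`,
`apTwistAt_update_succ`). -/
-- adapted from Literature/MathematicalPhysics/QuantumLattice/WilsonDiracAP.lean
theorem det_bondWilsonDirac_apTwistAt_update (E : Finset (Edge 4 L)) (s : Fin 4 → ZMod L)
    (μ : Fin 4) (v : ZMod L) (V : GaugeConfig 4 L (Matrix.unitaryGroup (Fin N) ℂ)) (m r : ℝ) :
    (bondWilsonDirac (unitaryFundamentalRep (Fin N) ℂ) E (apTwistAt (Function.update s μ v) V)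
        m r).det =
      (bondWilsonDirac (unitaryFundamentalRep (Fin N) ℂ) E (apTwistAt s V) m r).det := by
  obtain ⟨n, rfl⟩ : ∃ n : ℕ, v = s μ + n :=
    ⟨(v - s μ).val, by rw [ZMod.natCast_zmod_val, add_sub_cancel]⟩
  induction n with
  | zero => rw [Nat.cast_zero, add_zero, Function.update_eq_self]
  | succ n ih =>
    have h : Function.update s μ (s μ + (n + 1 : ℕ)) =
        Function.update (Function.update s μ (s μ + n)) μ
          (Function.update s μ (s μ + n) μ + 1) := by
      rw [Function.update_self, Function.update_idem, Nat.cast_succ, add_assoc]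
    rw [h, apTwistAt_update_succ, det_bondWilsonDirac_gaugeTransform, ih]

/-- **Seam independence of the diluted antiperiodic determinant**: the diluted determinant of
the sign-twisted `U(N)` field does not depend on where the four seams are placed. -/
theorem det_bondWilsonDirac_apTwistAt (E : Finset (Edge 4 L)) (s t : Fin 4 → ZMod L)
    (V : GaugeConfig 4 L (Matrix.unitaryGroup (Fin N) ℂ)) (m r : ℝ) :
    (bondWilsonDirac (unitaryFundamentalRep (Fin N) ℂ) E (apTwistAt s V) m r).det =
      (bondWilsonDirac (unitaryFundamentalRep (Fin N) ℂ) E (apTwistAt t V) m r).det := by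
  have hs : s = Function.update (Function.update (Function.update (Function.update t 0 (s 0))
      1 (s 1)) 2 (s 2)) 3 (s 3) := by
    funext μ
    fin_cases μ <;> simp
  rw [hs, det_bondWilsonDirac_apTwistAt_update, det_bondWilsonDirac_apTwistAt_update,
    det_bondWilsonDirac_apTwistAt_update, det_bondWilsonDirac_apTwistAt_update]

/-- **Translation covariance of the diluted antiperiodic determinant**: for the translate `E'`
of `E` by `v`, `det D_{E'}[apLift (τ_v U)] = det D_E[apLift U]` (the lift of the translated field
is the translate of the lift up to a relocation of the seams). -/
theorem det_bondWilsonDirac_apLift_torusConfigShift (v : TorusSite 4 L)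
    {E E' : Finset (Edge 4 L)} (hE : ∀ e, e ∈ E' ↔ (e.1 - v, e.2) ∈ E)
    (U : GaugeConfig 4 L (Matrix.specialUnitaryGroup (Fin N) ℂ)) (m r : ℝ) :
    (bondWilsonDirac (unitaryFundamentalRep (Fin N) ℂ) E' (apLift (torusConfigShift v U)) m r).det =
      (bondWilsonDirac (unitaryFundamentalRep (Fin N) ℂ) E (apLift U) m r).det := by
  set c : Fin 4 → ZMod L := fun _ => -1 with hc
  rw [apLift_eq_apTwistAt, apLift_eq_apTwistAt, ← hc, unitaryLift_torusConfigShift,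
    det_bondWilsonDirac_apTwistAt E' c (c - v + v), ← apTwistAt_torusConfigShift,
    det_bondWilsonDirac_torusConfigShift _ v hE, det_bondWilsonDirac_apTwistAt E (c - v) c]

/-- Translating by `ê₀` moves the closed slab at `a` onto the closed slab at `a + 1`:
`e ∈ slabBonds (a + 1) ℓ ↔ e - ê₀ ∈ slabBonds a ℓ`. -/
theorem mem_slabBonds_add_one_iff (a : ZMod L) (ℓ : ℕ) (e : Edge 4 L) :
    e ∈ slabBonds (a + 1) ℓ ↔ (e.1 - Pi.single (0 : Fin 4) (1 : ZMod L), e.2) ∈ slabBonds a ℓ := by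
  have h : e.1 0 - 1 - a = e.1 0 - (a + 1) := by ring
  simp only [mem_slabBonds, Pi.sub_apply, Pi.single_eq_same, h]

/-- **Time-translation covariance of the diluted `SU(N)` determinant of a closed slab**:
`det D^{AP}_{slab(a+1, ℓ)}[τ_{ê₀} U] = det D^{AP}_{slab(a, ℓ)}[U]`. -/
theorem det_bondWilsonDiracAP_slabBonds_add_one (a : ZMod L) (ℓ : ℕ)
    (U : GaugeConfig 4 L (Matrix.specialUnitaryGroup (Fin N) ℂ)) (m : ℝ) :
    (bondWilsonDiracAP (slabBonds (a + 1) ℓ)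
        (torusConfigShift (Pi.single (0 : Fin 4) (1 : ZMod L)) U) m).det =
      (bondWilsonDiracAP (slabBonds a ℓ) U m).det := by
  unfold bondWilsonDiracAP
  exact det_bondWilsonDirac_apLift_torusConfigShift _ (mem_slabBonds_add_one_iff a ℓ) U m 1

/-- Torus translations preserve the product measure on link configurations. -/
theorem measurePreserving_torusConfigShift {G : Type*} [MeasurableSpace G] (μ₀ : Measure G)
    [SigmaFinite μ₀] (v : TorusSite 4 L) :
    MeasurePreserving (torusConfigShift (G := G) v) (Measure.pi fun _ : Edge 4 L => μ₀)
      (Measure.pi fun _ : Edge 4 L => μ₀) :=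
  measurePreserving_arrowCongr' (fun _ : Edge 4 L => μ₀) (fun _ : Edge 4 L => μ₀)
    (torusEdgeShift v) (MeasurableEquiv.refl G) fun _ => MeasurePreserving.id _

end AP

end ShiftZb

/-- **Stub `shiftZb`** (time-translation covariance of the diluted signed partition function): moving
a closed slab by one time step does not change `Zb` (Haar invariance of the link measure, translation
invariance of the Wilson action, and the relocation of the antiperiodic seam by a `ℤ₂ ⊂ U(3)` gauge
transformation under which the diluted determinant is invariant). -/
theorem stub_shiftZb (Nf L : ℕ) [NeZero L] [Fact (1 < L)] (β : ℝ) (m : Fin Nf → ℝ) (a : ZMod L)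
    (ℓ : ℕ) :
    ∫ U, (∏ f, (bondWilsonDiracAP (slabBonds (a + 1) ℓ) U (m f)).det) *
            (Real.exp (-β * wilsonAction (fundamentalRep (Fin 3)) U) : ℂ)
          ∂(Measure.pi fun _ : Edge 4 L => haarProbability (Matrix.specialUnitaryGroup (Fin 3) ℂ)) =
      ∫ U, (∏ f, (bondWilsonDiracAP (slabBonds a ℓ) U (m f)).det) *
            (Real.exp (-β * wilsonAction (fundamentalRep (Fin 3)) U) : ℂ)
          ∂(Measure.pi fun _ : Edge 4 L => haarProbability (Matrix.specialUnitaryGroup (Fin 3) ℂ)) := by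
  have hmp := ShiftZb.measurePreserving_torusConfigShift (L := L)
    (haarProbability (Matrix.specialUnitaryGroup (Fin 3) ℂ)) (Pi.single (0 : Fin 4) (1 : ZMod L))
  refine ((hmp.integral_comp (torusConfigShift _).measurableEmbedding _).symm).trans ?_
  refine integral_congr_ae (ae_of_all _ fun U => ?_)
  dsimp only
  rw [wilsonAction_torusConfigShift]
  congr 1
  exact Finset.prod_congr rfl fun f _ => ShiftZb.det_bondWilsonDiracAP_slabBonds_add_one a ℓ U (m f)

end Summit.QuantumFields.QCD.Theorems.UnquenchedChessboardBoundLine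

end
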